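import Summits.KontsevichZagierPeriods.KontsevichZagierPeriods.Theses.FurushoPentagon
import Summits.KontsevichZagierPeriods.KontsevichZagierPeriods.Theorems.HoffmanRelationInKZ.Negative.HoffmanElement
import Literature.NumberTheory.Transcendental.KZProductIdeal
import Literature.NumberTheory.Transcendental.KZUnfolding
import Literature.NumberTheory.Transcendental.KZLogCalculusProofs
import Literature.NumberTheory.Transcendental.MZVWordShuffle
import Literature.NumberTheory.Transcendental.MZVSimplexRepProofs
import Literature.NumberTheory.Transcendental.SemialgebraicMapsProofs

/-!
# `HoffmanRelationInKZ`, line `dilation-homotopy-transposition`: the shuffle cells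

Stub `stub_shuffleCells` of the crux `HoffmanRelationInKZ` (stmt-KontsevichZagierPeriods-3930,
route FurushoPentagon).  The simplicial shuffle side `[{t ∈ Δⁿ, 0 < u < t₀}, ∏ ω_{εᵢ}(tᵢ)/(1 − u)]`
of a non-empty admissible `s` (weight `n`, word `ε`) exists, and every representation of that
shape is, modulo `KZ.relations`, `Σ_{g=1}^{n} [KZ.mzvRep (ε with 1 inserted at g)]`: off the null
walls `{u = tᵢ}` the domain is the disjoint union of the open cells `{y | insertNth g u t ∈ Δⁿ⁺¹}`
(iterated domain additivity), and `insertNth g u t = y ∘ Fin.cycleRange g` carries the word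
`ε.insertIdx g true`, so each cell is a coordinate permutation of a simplex representation.
References: Kontsevich–Zagier, *Periods* (2001), §1.2; Hoffman, Pacific J. Math. 152 (1992), 5.1.
-/

noncomputable section

open Set MeasureTheory MvPolynomial
open Literature.NumberTheory.Transcendental
open Literature.ModelTheory.ExponentialFields (IsSemialgebraic isSemialgebraic_setOf_eval_pos)

namespace Summit.KontsevichZagierPeriods.FurushoPentagon.HoffmanRelationInKZ

/-! ## Inserting a letter / a coordinate -/

/-- Reading a tuple along the cycle `(0 1 ⋯ p)` inserts its head at slot `p` of its tail. [folklore] -/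
theorem comp_cycleRange_eq_insertNth {α : Type*} {n : ℕ} (p : Fin (n + 1)) (w : Fin (n + 1) → α) :
    (fun i => w (Fin.cycleRange p i)) = (Fin.insertNth p (w 0) (Fin.tail w) : Fin (n + 1) → α) :=
  Fin.eq_insertNth_iff.2 ⟨by simp, funext fun j => by simp [Fin.removeNth, Fin.tail]⟩

/-- The inserted letter sits at the insertion slot. [folklore] -/
theorem getD_insertIdx_slot {ε : List Bool} {n : ℕ} (hε : ε.length = n) (p : Fin (n + 1)) :
    (ε.insertIdx p true).getD p false = true := by
  rw [List.getD_eq_getElem?_getD, List.getElem?_insertIdx_self, if_pos (by omega)]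
  rfl

/-- Off the insertion slot the letters are the old ones, read along `Fin.succAbove`. [folklore] -/
theorem getD_insertIdx_succAbove (ε : List Bool) {n : ℕ} (p : Fin (n + 1)) (j : Fin n) :
    (ε.insertIdx p true).getD (p.succAbove j) false = ε.getD j false := by
  rcases lt_or_ge (Fin.castSucc j) p with h | h
  · have h' : (j : ℕ) < (p : ℕ) := by simpa [Fin.lt_def] using h
    rw [Fin.succAbove_of_castSucc_lt _ _ h, Fin.val_castSucc, List.getD_eq_getElem?_getD,
      List.getD_eq_getElem?_getD, List.getElem?_insertIdx_of_lt h']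
  · have h' : (p : ℕ) < (j : ℕ) + 1 := by
      have := Fin.le_def.1 h; rw [Fin.val_castSucc] at this; omega
    rw [Fin.succAbove_of_le_castSucc _ _ h, Fin.val_succ, List.getD_eq_getElem?_getD,
      List.getD_eq_getElem?_getD, List.getElem?_insertIdx_of_gt h', Nat.add_sub_cancel]

/-- The word integrand of the inserted word at the inserted tuple factors as
`ω₁(u) · ∏ⱼ ω_{εⱼ}(tⱼ)`. [folklore] -/
theorem prod_mzvForm_insertNth {ε : List Bool} {n : ℕ} (hε : ε.length = n) (p : Fin (n + 1))
    (u : ℝ) (t : Fin n → ℝ) :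
    ∏ i : Fin (n + 1), KZ.mzvForm ((ε.insertIdx p true).getD i false)
        ((Fin.insertNth p u t : Fin (n + 1) → ℝ) i) =
      KZ.mzvForm true u * ∏ j : Fin n, KZ.mzvForm (ε.getD j false) (t j) := by
  rw [Fin.prod_univ_succAbove _ p]
  simp only [Fin.insertNth_apply_same, Fin.insertNth_apply_succAbove, getD_insertIdx_slot hε,
    getD_insertIdx_succAbove ε]

/-- Inserting `u` at slot `p` of `t` gives a strictly decreasing tuple iff `t` is strictly
decreasing and `u` lies below the entries before the slot and above those from the slot on.
[folklore] -/
theorem strictAnti_insertNth_iff {n : ℕ} {p : Fin (n + 1)} {u : ℝ} {t : Fin n → ℝ} :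
    StrictAnti (Fin.insertNth p u t : Fin (n + 1) → ℝ) ↔
      StrictAnti t ∧ (∀ a : Fin n, Fin.castSucc a < p → u < t a) ∧
        (∀ b : Fin n, p ≤ Fin.castSucc b → t b < u) := by
  refine ⟨fun h => ⟨fun a b hab => by simpa using h (Fin.strictMono_succAbove p hab),
    fun a ha => by simpa using h ((Fin.succAbove_lt_iff_castSucc_lt p a).2 ha),
    fun b hb => by simpa using h ((Fin.lt_succAbove_iff_le_castSucc p b).2 hb)⟩, ?_⟩
  rintro ⟨ht, hl, hr⟩ i j hij
  by_cases hi : i = p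
  · subst hi
    by_cases hj : j = i
    · exact absurd (hj ▸ hij) (lt_irrefl _)
    · obtain ⟨b, rfl⟩ := Fin.exists_succAbove_eq hj
      simpa using hr b ((Fin.lt_succAbove_iff_le_castSucc i b).1 hij)
  · obtain ⟨a, rfl⟩ := Fin.exists_succAbove_eq hi
    by_cases hj : j = p
    · subst hj
      simpa using hl a ((Fin.succAbove_lt_iff_castSucc_lt j a).1 hij)
    · obtain ⟨b, rfl⟩ := Fin.exists_succAbove_eq hj
      simpa using ht ((Fin.succAbove_lt_succAbove_iff).1 hij)

/-- Membership of an inserted tuple in the open ordered simplex. [folklore] -/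
theorem insertNth_mem_openOrderedSimplex_iff {n : ℕ} {p : Fin (n + 1)} {u : ℝ} {t : Fin n → ℝ} :
    (Fin.insertNth p u t : Fin (n + 1) → ℝ) ∈ KZ.openOrderedSimplex (n + 1) ↔
      t ∈ KZ.openOrderedSimplex n ∧ 0 < u ∧ u < 1 ∧ (∀ a : Fin n, Fin.castSucc a < p → u < t a) ∧
        (∀ b : Fin n, p ≤ Fin.castSucc b → t b < u) := by
  simp only [KZ.openOrderedSimplex, mem_setOf_eq, Fin.forall_iff_succAbove p,
    Fin.insertNth_apply_same, Fin.insertNth_apply_succAbove, strictAnti_insertNth_iff]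
  tauto

/-- **The cell representation.** The simplex representation of the inserted word, read along the
sorting permutation `Fin.cycleRange (q+1)` (one coordinate permutation,
`KZ.of_sub_of_reindex_mem_relations`), lives on the cell `{y | insertNth (q+1) (y 0) (tail y) ∈ Δⁿ⁺¹}`
with integrand `∏ⱼ ω_{εⱼ}(tⱼ) / (1 − u)`. [cite: KontsevichZagier2001, §1.2 rule (2)] -/
theorem exists_cellRep {k n : ℕ} (hk : k = n + 1) {ε : List Bool} (hε : ε.length = n) (q : Fin n)
    (r : KZ.IntegralRep k) (hd : r.domain = KZ.openOrderedSimplex k)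
    (hi : ∀ v, r.integrand v =
      ∏ i : Fin k, KZ.mzvForm ((ε.insertIdx ((q : ℕ) + 1) true).getD i false) (v i)) :
    ∃ R : KZ.IntegralRep (n + 1), KZ.of r - KZ.of R ∈ KZ.relations ∧
      R.domain = {y | (Fin.insertNth q.succ (y 0) (Fin.tail y) : Fin (n + 1) → ℝ) ∈
        KZ.openOrderedSimplex (n + 1)} ∧
      ∀ y, R.integrand y = (∏ j : Fin n, KZ.mzvForm (ε.getD j false) (Fin.tail y j)) / (1 - y 0) := by
  subst hk
  refine ⟨r.reindex (Fin.cycleRange q.succ), KZ.of_sub_of_reindex_mem_relations r _, ?_, fun y => ?_⟩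
  · ext y
    rw [KZ.IntegralRep.reindex_domain, hd, mem_setOf_eq, mem_setOf_eq, comp_cycleRange_eq_insertNth]
  · have h4 := prod_mzvForm_insertNth hε q.succ (y 0) (Fin.tail y)
    have hc : ∀ i, y (Fin.cycleRange q.succ i) =
        (Fin.insertNth q.succ (y 0) (Fin.tail y) : Fin (n + 1) → ℝ) i :=
      fun i => congrFun (comp_cycleRange_eq_insertNth q.succ y) i
    simp only [KZ.IntegralRep.reindex_integrand, hi, hc]
    simp only [Fin.val_succ] at h4
    rw [h4, KZ.mzvForm_true, one_div_mul_eq_div]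

/-! ## The cells of the shuffle domain -/

/-- In dimension `n + 1 ≥ 2` the coordinate `1` is the successor of `0 : Fin n`. [folklore] -/
theorem one_eq_succ_zero {n : ℕ} (hn : 0 < n) : (1 : Fin (n + 1)) = Fin.succ ⟨0, hn⟩ :=
  Fin.ext (by rw [Fin.val_one', Nat.mod_eq_of_lt (by omega)]; rfl)

/-- Every cell lies in the shuffle domain `{t ∈ Δⁿ, 0 < u < t₀}`. [folklore] -/
theorem cell_subset {n : ℕ} (hn : 0 < n) (q : Fin n) :
    {y : Fin (n + 1) → ℝ | (Fin.insertNth q.succ (y 0) (Fin.tail y) : Fin (n + 1) → ℝ) ∈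
        KZ.openOrderedSimplex (n + 1)} ⊆
      {y | Fin.tail y ∈ KZ.openOrderedSimplex n ∧ 0 < y 0 ∧ y 0 < y 1} := by
  intro y hy
  obtain ⟨ht, h0, -, hl, -⟩ := insertNth_mem_openOrderedSimplex_iff.1 hy
  exact ⟨ht, h0, by rw [one_eq_succ_zero hn]; exact hl ⟨0, hn⟩ (Fin.lt_def.2 (by simp))⟩

/-- Distinct cells are disjoint. [folklore] -/
theorem disjoint_cells {n : ℕ} {q q' : Fin n} (h : q ≠ q') :
    Disjoint {y : Fin (n + 1) → ℝ | (Fin.insertNth q.succ (y 0) (Fin.tail y) : Fin (n + 1) → ℝ) ∈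
        KZ.openOrderedSimplex (n + 1)}
      {y : Fin (n + 1) → ℝ | (Fin.insertNth q'.succ (y 0) (Fin.tail y) : Fin (n + 1) → ℝ) ∈
        KZ.openOrderedSimplex (n + 1)} := by
  wlog hlt : q < q' generalizing q q'
  · exact (this h.symm (lt_of_le_of_ne (not_lt.1 hlt) h.symm)).symm
  refine disjoint_left.2 fun y h1 h2 => ?_
  rw [mem_setOf_eq, insertNth_mem_openOrderedSimplex_iff] at h1 h2
  have hle : q.succ ≤ Fin.castSucc q' :=
    Fin.le_def.2 (by rw [Fin.val_succ, Fin.val_castSucc]; exact Fin.lt_def.1 hlt)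
  exact absurd ((h2.2.2.2.1 q' Fin.castSucc_lt_succ).trans (h1.2.2.2.2 q' hle)) (lt_irrefl _)

/-- **Off the walls `{u = tᵢ}` the shuffle domain is covered by the cells**: the rank of `u` among
`t₀ > ⋯ > t_{n-1}` is well defined there. [folklore] -/
theorem diff_cells_subset_walls {n : ℕ} (hn : 0 < n) :
    {y : Fin (n + 1) → ℝ | Fin.tail y ∈ KZ.openOrderedSimplex n ∧ 0 < y 0 ∧ y 0 < y 1} \
        (⋃ q : Fin n, {y : Fin (n + 1) → ℝ | (Fin.insertNth q.succ (y 0) (Fin.tail y) :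
          Fin (n + 1) → ℝ) ∈ KZ.openOrderedSimplex (n + 1)}) ⊆
      ⋃ i : Fin n, {y | y 0 = y i.succ} := by
  classical
  rintro y ⟨⟨ht, h0, h01⟩, hnot⟩
  by_contra hne
  simp only [mem_iUnion, mem_setOf_eq, not_exists] at hne
  rw [one_eq_succ_zero hn] at h01
  -- the rank `m` of `u = y 0`: the entries from `m` on lie below `u`, those before `m` above
  have hP : ∃ m : ℕ, ∀ b : Fin n, m ≤ (b : ℕ) → Fin.tail y b < y 0 :=
    ⟨n, fun b hb => absurd hb (not_le.2 b.2)⟩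
  have hmspec : ∀ b : Fin n, Nat.find hP ≤ (b : ℕ) → Fin.tail y b < y 0 := Nat.find_spec hP
  have hmn : Nat.find hP ≤ n := Nat.find_min' hP fun b hb => absurd hb (not_le.2 b.2)
  have hm0 : Nat.find hP ≠ 0 := fun h =>
    absurd (h01.trans (hmspec ⟨0, hn⟩ (by simp [h]))) (lt_irrefl _)
  have hbelow : ∀ a : Fin n, (a : ℕ) < Nat.find hP → y 0 < Fin.tail y a := by
    intro a ha
    have hna : ¬ ∀ b : Fin n, (a : ℕ) ≤ (b : ℕ) → Fin.tail y b < y 0 := Nat.find_min hP ha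
    push Not at hna
    obtain ⟨b, hab, hb⟩ := hna
    exact lt_of_le_of_ne (hb.trans (ht.2.2.antitone (Fin.le_def.2 hab))) (hne a)
  refine hnot (mem_iUnion.2 ⟨⟨Nat.find hP - 1, by omega⟩, ?_⟩)
  rw [mem_setOf_eq, insertNth_mem_openOrderedSimplex_iff]
  refine ⟨ht, h0, h01.trans (ht.2.1 _), fun a ha => hbelow a ?_, fun b hb => hmspec b ?_⟩
  · have := Fin.lt_def.1 ha; simp only [Fin.val_castSucc, Fin.val_succ] at this; omega
  · have := Fin.le_def.1 hb; simp only [Fin.val_castSucc, Fin.val_succ] at this; omega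

/-- A diagonal hyperplane `{y 0 = y j}` (`j ≠ 0`) is Lebesgue-null (a proper linear subspace).
[folklore] -/
theorem volume_setOf_apply_zero_eq {n : ℕ} (j : Fin (n + 1)) (hj : j ≠ 0) :
    volume {y : Fin (n + 1) → ℝ | y 0 = y j} = 0 := by
  let L : (Fin (n + 1) → ℝ) →ₗ[ℝ] ℝ :=
    LinearMap.proj (R := ℝ) (φ := fun _ : Fin (n + 1) => ℝ) 0 -
      LinearMap.proj (R := ℝ) (φ := fun _ : Fin (n + 1) => ℝ) j
  have hL : ∀ y, L y = y 0 - y j := fun y => rfl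
  have hset : {y : Fin (n + 1) → ℝ | y 0 = y j} = (LinearMap.ker L : Set (Fin (n + 1) → ℝ)) := by
    ext y
    simp [hL, sub_eq_zero]
  rw [hset]
  refine Measure.addHaar_submodule volume (LinearMap.ker L) fun htop => ?_
  have hmem : (Pi.single 0 1 : Fin (n + 1) → ℝ) ∈ LinearMap.ker L := htop ▸ Submodule.mem_top
  rw [LinearMap.mem_ker, hL, Pi.single_eq_same, Pi.single_eq_of_ne hj, sub_zero] at hmem
  exact one_ne_zero hmem

/-- The shuffle domain `{(u, t) | t ∈ Δⁿ, 0 < u < t₀}` is `ℚ`-semialgebraic. [folklore] -/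
theorem isSemialgebraic_shuffleDomain (n : ℕ) :
    IsSemialgebraic ℚ {y : Fin (n + 1) → ℝ | Fin.tail y ∈ KZ.openOrderedSimplex n ∧
      0 < y 0 ∧ y 0 < y 1} := by
  have h1 : IsSemialgebraic ℚ ((fun y : Fin (n + 1) → ℝ => y ∘ Fin.succ) ⁻¹'
      KZ.openOrderedSimplex n) :=
    (KZ.isSemialgebraic_openOrderedSimplex n).preimage_comp Fin.succ
  have h2 := isSemialgebraic_setOf_eval_pos (R := ℝ) (X 0 : MvPolynomial (Fin (n + 1)) ℚ)
  have h3 := isSemialgebraic_setOf_eval_pos (R := ℝ) (X 1 - X 0 : MvPolynomial (Fin (n + 1)) ℚ)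
  convert (h1.inter h2).inter h3 using 1
  ext y
  simp only [mem_setOf_eq, mem_inter_iff, mem_preimage, map_sub, MvPolynomial.aeval_X, sub_pos,
    and_assoc]
  exact Iff.rfl

/-- The shuffle integrand `∏ ω_{εᵢ}(tᵢ)/(1 − u)` is a quotient of `ℚ`-polynomials with non-vanishing
denominator on the shuffle domain, hence `ℚ`-semialgebraic there. [cite: KontsevichZagier2001, §1.1] -/
theorem isSemialgebraicFunOn_shuffleIntegrand (s : List ℕ) (hn : 0 < MZV.weight s) :
    IsSemialgebraicFunOn ℚ
      {y : Fin (MZV.weight s + 1) → ℝ | Fin.tail y ∈ KZ.openOrderedSimplex (MZV.weight s) ∧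
        0 < y 0 ∧ y 0 < y 1}
      (fun y => KZ.mzvIntegrand s (Fin.tail y) / (1 - y 0)) := by
  set Q : MvPolynomial (Fin (MZV.weight s + 1)) ℚ := (1 - X 0) * rename Fin.succ
    (∏ i : Fin (MZV.weight s), (if (MZV.binaryWord s).getD i false then 1 - X i else X i :
      MvPolynomial (Fin (MZV.weight s)) ℚ))
  have hQ : ∀ y : Fin (MZV.weight s + 1) → ℝ, aeval y Q = (1 - y 0) * aeval (Fin.tail y)
      (∏ i : Fin (MZV.weight s), (if (MZV.binaryWord s).getD i false then 1 - X i else X i :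
        MvPolynomial (Fin (MZV.weight s)) ℚ)) :=
    fun y => by simp only [Q, map_mul, map_sub, map_one, aeval_X, aeval_rename]; rfl
  refine (isSemialgebraicFunOn_aeval_div_aeval (isSemialgebraic_shuffleDomain _) 1 Q ?_).congr ?_
  · rintro y ⟨ht, -, h01⟩
    rw [hQ]
    refine mul_ne_zero (sub_pos.2 (h01.trans ?_)).ne'
      (KZ.aeval_prod_ne_zero_of_mem_openOrderedSimplex s ht)
    rw [one_eq_succ_zero hn]
    exact ht.2.1 ⟨0, hn⟩
  · intro y _
    simp only
    rw [map_one, hQ, KZ.mzvIntegrand_eq_aeval_div_aeval, map_one, div_div, mul_comm]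

/-! ## Iterated domain additivity -/

/-- **Dissection modulo a null set** (iterated domain additivity): if the pairwise disjoint domains
of the `Rs i` lie in `R.domain` and exhaust it up to a null set, with matching integrands, then
`[R] − Σᵢ [Rs i]` is a relation (peel off one piece at a time; a null domain is a relation).
[cite: KontsevichZagier2001, §1.2 rule (1)] -/
theorem of_sub_sum_of_mem_relations {N : ℕ} :
    ∀ (k : ℕ) (R : KZ.IntegralRep N) (Rs : Fin k → KZ.IntegralRep N),
      (∀ i, (Rs i).domain ⊆ R.domain) → volume (R.domain \ ⋃ i, (Rs i).domain) = 0 →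
      (∀ i j, i ≠ j → Disjoint (Rs i).domain (Rs j).domain) →
      (∀ i, EqOn R.integrand (Rs i).integrand (Rs i).domain) →
      KZ.of R - ∑ i, KZ.of (Rs i) ∈ KZ.relations
  | 0, R, Rs, _, hnull, _, _ => by
    have h0 : volume R.domain = 0 := by simpa using hnull
    simpa using KZ.of_mem_relations_of_volume_eq_zero R h0
  | k + 1, R, Rs, hsub, hnull, hdisj, hint => by
    have hS : IsSemialgebraic ℚ (R.domain \ (Rs (Fin.last k)).domain) :=
      R.isSemialgebraic_domain.diff (Rs _).isSemialgebraic_domain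
    have hU : (⋃ i, (Rs i).domain) =
        (⋃ i : Fin k, (Rs (Fin.castSucc i)).domain) ∪ (Rs (Fin.last k)).domain := by
      rw [iUnion_fin_add_one_eq_iUnion_castSucc]; rfl
    have h1 : KZ.of R - KZ.of (R.restrict _ hS sdiff_subset) - KZ.of (Rs (Fin.last k)) ∈
        KZ.relations := by
      refine KZ.domainAddRel_subset_relations ⟨N, R, R.restrict _ hS sdiff_subset,
        Rs (Fin.last k), ?_, ?_, fun _ _ => rfl, hint _, rfl⟩
      · rw [KZ.IntegralRep.domain_restrict, sdiff_union_of_subset (hsub _)]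
      · rw [KZ.IntegralRep.domain_restrict, sdiff_inter_self, measure_empty]
    have h2 : KZ.of (R.restrict _ hS sdiff_subset) - ∑ i : Fin k, KZ.of (Rs (Fin.castSucc i)) ∈
        KZ.relations := by
      refine of_sub_sum_of_mem_relations k _ (fun i => Rs (Fin.castSucc i))
        (fun i => subset_sdiff.2 ⟨hsub _, hdisj _ _ (Fin.castSucc_lt_last i).ne⟩) ?_
        (fun i j hij => hdisj _ _ fun h => hij (Fin.castSucc_injective _ h)) fun i => hint _
      rw [KZ.IntegralRep.domain_restrict, sdiff_sdiff, union_comm, ← hU]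
      exact hnull
    rw [Fin.sum_univ_castSucc]
    have : KZ.of R - (∑ i : Fin k, KZ.of (Rs (Fin.castSucc i)) + KZ.of (Rs (Fin.last k))) =
        (KZ.of R - KZ.of (R.restrict _ hS sdiff_subset) - KZ.of (Rs (Fin.last k))) +
          (KZ.of (R.restrict _ hS sdiff_subset) - ∑ i : Fin k, KZ.of (Rs (Fin.castSucc i))) := by
      abel
    rw [this]
    exact KZ.relations.add_mem h1 h2

/-! ## The inserted words and the main theorem -/

/-- For admissible non-empty `s` of weight `n` and a gap `q + 1 ∈ {1, …, n}`, the word of `s` with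
the letter `1` inserted at the gap is non-empty, ends with `1`, does not begin with `1`, and has
length `n + 1`. [folklore] -/
theorem insertIdx_binaryWord {s : List ℕ} (hs : MZV.IsAdmissible s) (hne : s ≠ [])
    (q : Fin (MZV.weight s)) :
    (MZV.binaryWord s).insertIdx ((q : ℕ) + 1) true ≠ [] ∧
      ((MZV.binaryWord s).insertIdx ((q : ℕ) + 1) true).getLast? = some true ∧
      ((MZV.binaryWord s).insertIdx ((q : ℕ) + 1) true).head? ≠ some true ∧
      ((MZV.binaryWord s).insertIdx ((q : ℕ) + 1) true).length = MZV.weight s + 1 := by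
  have hlen : (MZV.binaryWord s).length = MZV.weight s := hs.length_binaryWord
  have hq : (q : ℕ) + 1 ≤ (MZV.binaryWord s).length := by rw [hlen]; exact q.2
  have hlen' : ((MZV.binaryWord s).insertIdx ((q : ℕ) + 1) true).length = MZV.weight s + 1 := by
    rw [List.length_insertIdx_of_le_length hq, hlen]
  refine ⟨List.ne_nil_of_length_eq_add_one hlen', ?_, ?_, hlen'⟩
  · rw [List.getLast?_eq_getElem?, hlen', Nat.add_sub_cancel, List.getElem?_insertIdx]
    have hq2 := q.2
    rcases Nat.lt_or_ge ((q : ℕ) + 1) (MZV.weight s) with h | h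
    · rw [if_neg (by omega), if_neg (by omega), ← MZV.getLast?_binaryWord hne,
        List.getLast?_eq_getElem?, hlen]
    · rw [if_neg (by omega), if_pos (by omega), if_pos (by omega)]
  · obtain ⟨a, s', rfl⟩ := List.exists_cons_of_ne_nil hne
    have ha : 2 ≤ a := hs.2 (List.cons_ne_nil a s')
    rw [List.head?_eq_getElem?, List.getElem?_insertIdx_of_lt (Nat.succ_pos _),
      ← List.head?_eq_getElem?, MZV.head?_binaryWord (s := s') ha]
    simp

/-- STUB (shuffle side = dissection by the rank of `u`).  For a non-empty admissible `s` of weight `n` and a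
pinned `Z`: the simplicial shuffle side `[{t ∈ Δⁿ, 0 < u < t₀}, ∏ω_{εᵢ}(tᵢ)/(1−u)]` EXISTS, and every
representation of that shape is, modulo `KZ.relations`, the sum over the gaps `g = 1, …, n` of the simplex
classes of the word of `s` with the letter `1` inserted at gap `g` (`List.insertIdx g true`): remove the
null walls `{u = tᵢ}` (domain additivity + `KZ.of_mem_levelRel_of_volume_eq_zero`), split the rest into
the `n` open cells `{t₁ > ⋯ > t_g > u > t_{g+1} > ⋯}` (domain additivity), and identify each cell with a
coordinate permutation (`KZ.of_sub_of_reindex_mem_relations`) of `KZ.mzvRep` of the inserted word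
(`MZV.binaryWord_ofBinaryWord`, `MZV.isAdmissible_ofBinaryWord`, `MZV.weight_ofBinaryWord`).
[cite: KontsevichZagier2001, §1.2 rule (1)] -/
theorem stub_shuffleCells : ∀ (s : List ℕ) (hs : MZV.IsAdmissible s), s ≠ [] → ∀ Z : List ℕ → KZ.FormalRep, (∀ (u : List ℕ) (hu : MZV.IsAdmissible u), Z u = KZ.of (KZ.mzvRep u hu (KZ.mzvIntegrand_isSemialgebraicFunOn_holds u) (KZ.mzvIntegrand_integrableOn_holds u hu))) → (∃ r' : KZ.IntegralRep (MZV.weight s + 1), (r'.domain = {y : Fin (MZV.weight s + 1) → ℝ | Fin.tail y ∈ KZ.openOrderedSimplex (MZV.weight s) ∧ 0 < y 0 ∧ y 0 < y 1} ∧ Set.EqOn r'.integrand (fun y => KZ.mzvIntegrand s (Fin.tail y) / (1 - y 0)) r'.domain)) ∧ ∀ r' : KZ.IntegralRep (MZV.weight s + 1), (r'.domain = {y : Fin (MZV.weight s + 1) → ℝ | Fin.tail y ∈ KZ.openOrderedSimplex (MZV.weight s) ∧ 0 < y 0 ∧ y 0 < y 1} ∧ Set.EqOn r'.integrand (fun y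 => KZ.mzvIntegrand s (Fin.tail y) / (1 - y 0)) r'.domain) → KZ.of r' - ((List.range (MZV.weight s)).map (fun g => Z (MZV.ofBinaryWord ((MZV.binaryWord s).insertIdx (g + 1) true)))).sum ∈ KZ.relations := by
  intro s hs hne Z hZ
  have hn : 0 < MZV.weight s := by
    obtain ⟨a, t, rfl⟩ := List.exists_cons_of_ne_nil hne
    have ha : 2 ≤ a := hs.2 (List.cons_ne_nil a t)
    simp only [MZV.weight, List.sum_cons]; omega
  have hε : (MZV.binaryWord s).length = MZV.weight s := hs.length_binaryWord
  -- the cells: coordinate permutations of the simplex classes of the inserted words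
  have hcell : ∀ q : Fin (MZV.weight s), ∃ R : KZ.IntegralRep (MZV.weight s + 1),
      Z (MZV.ofBinaryWord ((MZV.binaryWord s).insertIdx ((q : ℕ) + 1) true)) - KZ.of R ∈
        KZ.relations ∧
      R.domain = {y | (Fin.insertNth q.succ (y 0) (Fin.tail y) : Fin (MZV.weight s + 1) → ℝ) ∈
        KZ.openOrderedSimplex (MZV.weight s + 1)} ∧
      R.integrand = fun y => KZ.mzvIntegrand s (Fin.tail y) / (1 - y 0) := by
    intro q
    obtain ⟨hne', hlast, hhead, hlen⟩ := insertIdx_binaryWord hs hne q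
    have hadm : MZV.IsAdmissible
        (MZV.ofBinaryWord ((MZV.binaryWord s).insertIdx ((q : ℕ) + 1) true)) :=
      MZV.isAdmissible_ofBinaryWord hhead
    have hbw := MZV.binaryWord_ofBinaryWord hne' hlast
    have hw : MZV.weight (MZV.ofBinaryWord ((MZV.binaryWord s).insertIdx ((q : ℕ) + 1) true)) =
        MZV.weight s + 1 := (MZV.weight_ofBinaryWord hne' hlast).trans hlen
    obtain ⟨R, hR, hRd, hRi⟩ := exists_cellRep hw hε q
      (KZ.mzvRep _ hadm (KZ.mzvIntegrand_isSemialgebraicFunOn_holds _)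
        (KZ.mzvIntegrand_integrableOn_holds _ hadm))
      rfl (fun v => by show KZ.mzvIntegrand _ v = _; rw [KZ.mzvIntegrand, hbw])
    exact ⟨R, by rw [hZ _ hadm]; exact hR, hRd, funext fun y => by rw [hRi]; rfl⟩
  choose R hRZ hRd hRi using hcell
  set D := {y : Fin (MZV.weight s + 1) → ℝ | Fin.tail y ∈ KZ.openOrderedSimplex (MZV.weight s) ∧
    0 < y 0 ∧ y 0 < y 1}
  set F : (Fin (MZV.weight s + 1) → ℝ) → ℝ := fun y => KZ.mzvIntegrand s (Fin.tail y) / (1 - y 0)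
  -- geometry: the cells lie in `D`, are pairwise disjoint, and cover `D` off the null walls
  have hCsub : ∀ q, (R q).domain ⊆ D := fun q => by rw [hRd]; exact cell_subset hn q
  have hnull : volume (D \ ⋃ q, (R q).domain) = 0 := by
    rw [iUnion_congr hRd]
    exact measure_mono_null (diff_cells_subset_walls hn) (measure_iUnion_null_iff.2 fun i =>
      volume_setOf_apply_zero_eq i.succ (Fin.succ_ne_zero i))
  have hdisj : ∀ q q', q ≠ q' → Disjoint (R q).domain (R q').domain := fun q q' h => by
    rw [hRd, hRd]; exact disjoint_cells h
  -- existence: integrable on each cell (a reindexed simplex representation) and on the null rest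
  have hFint : IntegrableOn F D := by
    have hI1 : IntegrableOn F (D \ ⋃ q, (R q).domain) := by
      rw [IntegrableOn, Measure.restrict_eq_zero.2 hnull]
      exact integrable_zero_measure
    have hI2 : IntegrableOn F (⋃ q, (R q).domain) :=
      integrableOn_finite_iUnion.2 fun q => by rw [← hRi q]; exact (R q).integrableOn
    exact (hI1.union hI2).mono_set (by rw [sdiff_union_of_subset (iUnion_subset hCsub)])
  refine ⟨⟨⟨D, F, isSemialgebraic_shuffleDomain _, isSemialgebraicFunOn_shuffleIntegrand s hn,
    hFint⟩, rfl, fun _ _ => rfl⟩, ?_⟩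
  -- the dissection of an arbitrary representation of the shuffle shape
  rintro r' ⟨hr'd, hr'i⟩
  have h1 : KZ.of r' - ∑ q, KZ.of (R q) ∈ KZ.relations :=
    of_sub_sum_of_mem_relations _ r' R (fun q => by rw [hr'd]; exact hCsub q)
      (by rw [hr'd]; exact hnull) hdisj
      fun q y hy => by rw [hRi q]; exact hr'i (by rw [hr'd]; exact hCsub q hy)
  have h2 : ∑ q : Fin (MZV.weight s),
      (Z (MZV.ofBinaryWord ((MZV.binaryWord s).insertIdx ((q : ℕ) + 1) true)) - KZ.of (R q)) ∈
        KZ.relations := sum_mem fun q _ => hRZ q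
  rw [Summit.KontsevichZagierPeriods.HoffmanRelationInKZ.Negative.list_sum_range_map_fin]
  convert KZ.relations.sub_mem h1 h2 using 1
  rw [Finset.sum_sub_distrib]
  abel

end Summit.KontsevichZagierPeriods.FurushoPentagon.HoffmanRelationInKZ
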